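import Summits.RiemannHypothesis.RiemannHypothesis.Theorems.TiltedLandingLaw421R3Lens1LinkTol
import Summits.RiemannHypothesis.RiemannHypothesis.Theorems.TiltedLandingLaw421R3Lens1NoLanding
import Summits.RiemannHypothesis.RiemannHypothesis.Theorems.TiltedLandingLaw421R3Lens1LinkTolNeg20Pre
import Summits.RiemannHypothesis.RiemannHypothesis.Theorems.TiltedLandingLaw421R3Lens1LinkTolNeg20Legal

/-!
# `TiltedLandingLaw421R` (crux stmt-RiemannHypothesis-33346) — «Lens1LinkTolNeg20»: NEG 20 in the kernel (slot 164)

Nothing here bears on the truth of RH; RH is not proved; a polynomial is not `ξ`.  NEG 20 of record ((CA1154)(2)):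
the link-only two-disc law `RhW08.Lens1LinkTol.TopLinkLawTolQ (1/10)` («Lens1LinkTol», #1309) is FALSE AS TYPED —
`not_topLinkLawTolQ_tenth : ¬ TopLinkLawTolQ (1/10)`.  Witness: the row L1 = {±i, ±5/4 ± (22/25) i}, tilt 0, top `T = i`,
`F z = (z² + 1)(z⁴ − (7881/5000) z² + 546110161/10⁸)` with the legal book tuple `(C, η, x₀, s, hmax, R, Hs, B) =
(2, 1/2, 0, 1/2, 1, 40, 1, 100)` («Lens1LinkTolNeg20Legal», C6 g47: `engineHyps5_L1`).  Proof (≈ 10 lines over three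
landed modules): specialise the law at `(F, j = 0, a = i)` with the frame-side binders of «Lens1LinkTolNeg20Pre»
(`F_I`, `noTallerToucher_F_I`, `not_jensenIsolated_F_I`, `deriv_F_I_ne`); its band partner `a′` is forced to be `i`
(`partner_eq_I`: no zero other than `i` has `Im ≥ 9/10`); the lone-pair identity `halfLink₂_self_iff` («Lens1LinkTol»)
turns `HalfLink₂ F 0 i i` into part N's `HalfLink F 0 i`; and ★★★`RhW08.Lens1NoLanding.not_halfLink_of_baseSlope`
(«Lens1NoLanding») refutes that from (i) `hnr_F_I` (no critical point in the closed Jensen disc above the axis) and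
(ii) `hbase_F_I` (`Re φ′ > 0` on the tooth-free base).  `base_disjunct_at_I` records that the LINK-OR-BASE law
`RhW08.Lens1LinkTol.TopLinkOrBaseLawQ (1/10)` is NOT touched: its second disjunct (a base NL event at `x⋆ = 0` under
the top) holds on this very frame.  Certificates: C6 g47 RESULT-2/5/6 (row, (i)/(ii), legality), crit-1 g9 LEGAL 16/16
(l.10443), lens-1 g10 chains 06656f7b / 149e0f85.  Fully proved, standard axioms; filed
`--supports stmt-RiemannHypothesis-33346` by the lead of record from the image keyed by director-rh.
-/

namespace RhW08.Lens1LinkTolNeg20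

open Complex RhW08.Lens1ArcSign RhW08.Lens1LinkTol RhW08.Lens1NoLanding RhW08.Lens1LinkTolNeg20Pre
open RhIdea6.G17.W07C7 RhIdea6.G17.W07C7.Rev6

/-- the two row-L1 frames agree literally: «Lens1LinkTolNeg20Pre».F = «Lens1LinkTolNeg20Legal».F. -/
theorem F_eq_legal : RhW08.Lens1LinkTolNeg20Pre.F = RhW08.Lens1LinkTolNeg20Legal.F := rfl

/-- the legality datum of «Lens1LinkTolNeg20Legal» transported to «Lens1LinkTolNeg20Pre».F. -/
theorem engineHyps5_L1_pre : EngineHyps5 2 (1 / 2) RhW08.Lens1LinkTolNeg20Pre.F 0 (1 / 2) 1 40 1 100 := by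
  rw [F_eq_legal]; exact RhW08.Lens1LinkTolNeg20Legal.engineHyps5_L1

/-- NEG 20 modulo a legal frame: for every legal book tuple of the row-L1 frame `F`, the link-only two-disc law at
`θ = 1/10` fails — the law's partner is the top `i` itself, and the lone-pair half-link is refuted by ★★★. -/
theorem not_topLinkLawTolQ_tenth_of_legal {η x₀ s hmax R Hs : ℝ} {B : ℕ}
    (hE : EngineHyps5 2 η RhW08.Lens1LinkTolNeg20Pre.F x₀ s hmax R Hs B) : ¬ TopLinkLawTolQ (1 / 10) := by
  intro hL
  have hI : (0 : ℝ) < (Complex.I).im := by simp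
  obtain ⟨a', ha', hlo, -, -, -, hlink⟩ := hL η RhW08.Lens1LinkTolNeg20Pre.F x₀ s hmax R Hs B hE 0 Complex.I
    F_I hI noTallerToucher_F_I not_jensenIsolated_F_I deriv_F_I_ne
  have ha'I : a' = Complex.I := partner_eq_I ha' hlo
  rw [ha'I] at hlink
  exact not_halfLink_of_baseSlope hE F_I deriv_F_I_ne hI hnr_F_I hbase_F_I (halfLink₂_self_iff.mp hlink)

/-- ★★ NEG 20: `¬ TopLinkLawTolQ (1/10)` — the link-only two-disc law of «Lens1LinkTol» is false as typed. -/
theorem not_topLinkLawTolQ_tenth : ¬ TopLinkLawTolQ (1 / 10) :=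
  not_topLinkLawTolQ_tenth_of_legal engineHyps5_L1_pre

/-- on the same frame and top, the second disjunct of `TopLinkOrBaseLawQ (1/10)` holds: a base NL event at `x⋆ = 0`
with `|x⋆ − Re i| ≤ Im i` (NEG 20 leaves the link-or-base law open). -/
theorem base_disjunct_at_I :
    ∃ x : ℝ, |x - (Complex.I).re| ≤ (Complex.I).im ∧ NLEventOf RhW08.Lens1LinkTolNeg20Pre.F 0 x :=
  ⟨0, by simp, nlEvent_F_zero⟩

end RhW08.Lens1LinkTolNeg20
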